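import Mathlib
import Summits.Ventures.HodgeRepro2.PeterssonSpace
import Summits.Ventures.HodgeRepro2.HolomorphicPeterssonSpace
import Summits.Ventures.HodgeRepro2.HodgePeterssonBridge
import Summits.Ventures.HodgeRepro2.T5HodgePairing

/-!
# MultiplicityOnePeriod — multiplicity one reduces `(N)` to the non-vanishing of the two forms

Blind cell `pub-hodge-repro2`, seat p2 (Tier 5, sub-step N1 = IDENTIFICATION, §ID-4–ID-5).

Lemma A7.1 of TIER4 («in particular, if `ω_cd = λ · ω_ab` with `λ ≠ 0` then `(N)` for `σ` iff
`ω_ab ≠ 0`») and the multiplicity-one input of N1 §ID-3(d) say: once the two (2,0)-forms `ω_ab`,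
`ω_cd` lie in a ONE-DIMENSIONAL piece of `H^{2,0}(S)` (the isotypic line of the relevant
automorphic representation), the period `∫_S ω_ab ∧ \overline{ω_cd}` is non-zero iff both forms
are non-zero. This file proves that sentence in kernel on the Petersson space of the compact
Picard modular surface (`PeterssonSpace.lean`), using

* `HodgePeterssonBridge.lean`: `∫_{val '' D} ω_f ∧ \overline{ω_g} = 4 ⟨f, g⟩_Pet`;
* `PeterssonSpace.lean`: the Petersson space is an honest inner product space and two forms have
  the same class iff they agree on the ball;
* p6's `T5HodgePairing.inner_ne_zero_iff_of_finrank_eq_one` (imported, not restated): in a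
  one-dimensional subspace of an inner product space, `⟪ω, ω'⟫ ≠ 0 ↔ ω ≠ 0 ∧ ω' ≠ 0`.

The one-dimensional subspace may be taken to be a joint eigenspace of the Hecke operators
(`exists_orthonormalBasis_heckeSpace` / `JointEigenbasis.commonEigenspace`); that its dimension is
one is the multiplicity-one input (prose, carried as a hypothesis).
-/

namespace Summit.Ventures.HodgeRepro2.ShimuraData

open MeasureTheory JointEigenbasis

variable {K : Type*} [Field K] [NumberField K] [NumberField.IsCMField K] {τ₁ : K →+* ℂ}
  {H : Matrix (Fin 3) (Fin 3) K} {Q : Matrix (Fin 3) (Fin 3) ℂ} (hQ : IsFrame K τ₁ H Q)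
  (S : Subgroup (GL (Fin 3) K)) (hS : (S : Set (GL (Fin 3) K)) ⊆ unitaryGroup K H)
  [CompactSpace (ballQuotient hQ S hS)] {D : Set ball₂} (k : ℕ)
  (hD : IsBallFundamentalDomain hQ S hS D)

/-- The class of a form in the Petersson space is non-zero iff the form does not vanish
identically on the ball. -/
theorem PeterssonSpace.mk_ne_zero_iff (f : PeterssonForms hQ S hS k hD) :
    (SeparationQuotient.mk f : PeterssonSpace hQ S hS k hD) ≠ 0
      ↔ ∃ z ∈ ball₂, (PeterssonForms.toForm hQ S hS k hD f : (Fin 2 → ℂ) → ℂ) z ≠ 0 := by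
  rw [ne_eq, ← SeparationQuotient.mk_zero, PeterssonSpace.mk_eq_mk_iff]
  simp only [not_forall, exists_prop]
  rfl

/-- The inner product of two classes is the Petersson product of representatives (Mathlib's
convention `⟪f, g⟫ = ⟨g, f⟩_Pet`). -/
theorem PeterssonSpace.inner_mk_mk (f g : PeterssonForms hQ S hS k hD) :
    inner ℂ (SeparationQuotient.mk f : PeterssonSpace hQ S hS k hD) (SeparationQuotient.mk g)
      = peterssonInner hQ S hS (quotientMeasure hQ S hS D)
        ((mem_weightForms τ₁ Q S k).mp (PeterssonForms.toForm hQ S hS k hD g).2).1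
        ((mem_weightForms τ₁ Q S k).mp (PeterssonForms.toForm hQ S hS k hD f).2).1 := rfl

/-- **The bridge on the Petersson space**: the coefficient-model period of two weight-3 forms over a
measurable fundamental domain is `4 ×` the inner product of their classes (in the order
`⟪mk g, mk f⟫ = ⟨f, g⟩_Pet`). -/
theorem setIntegral_hodgeWedge_eq_inner_mk (hDm : MeasurableSet D)
    (f g : PeterssonForms hQ S hS 3 hD) :
    ∫ x in Subtype.val '' D, hodgeWedge (PeterssonForms.toForm hQ S hS 3 hD f)
        (PeterssonForms.toForm hQ S hS 3 hD g) x
      = 4 * inner ℂ (SeparationQuotient.mk g : PeterssonSpace hQ S hS 3 hD)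
          (SeparationQuotient.mk f) := by
  rw [PeterssonSpace.inner_mk_mk]
  exact setIntegral_hodgeWedge_eq_peterssonInner hQ S hS hDm
    ((mem_weightForms τ₁ Q S 3).mp (PeterssonForms.toForm hQ S hS 3 hD f).2).1
    ((mem_weightForms τ₁ Q S 3).mp (PeterssonForms.toForm hQ S hS 3 hD g).2).1
    ((mem_weightForms τ₁ Q S 3).mp (PeterssonForms.toForm hQ S hS 3 hD f).2).2
    ((mem_weightForms τ₁ Q S 3).mp (PeterssonForms.toForm hQ S hS 3 hD g).2).2

/-- **Multiplicity one reduces `(N)` to non-vanishing** (Lemma A7.1 «in particular» + N1 §ID-5):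
if the classes of two weight-3 forms `f`, `g` lie in a one-dimensional subspace `L` of the
Petersson space, then the period `∫ ω_f ∧ \overline{ω_g}` over a measurable fundamental domain is
non-zero iff neither form vanishes identically on the ball. -/
theorem setIntegral_hodgeWedge_ne_zero_iff_of_finrank_eq_one (hDm : MeasurableSet D)
    (L : Submodule ℂ (PeterssonSpace hQ S hS 3 hD)) (hL : Module.finrank ℂ L = 1)
    (f g : PeterssonForms hQ S hS 3 hD) (hf : (SeparationQuotient.mk f : PeterssonSpace hQ S hS 3 hD) ∈ L)
    (hg : (SeparationQuotient.mk g : PeterssonSpace hQ S hS 3 hD) ∈ L) :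
    ∫ x in Subtype.val '' D, hodgeWedge (PeterssonForms.toForm hQ S hS 3 hD f)
        (PeterssonForms.toForm hQ S hS 3 hD g) x ≠ 0
      ↔ (∃ z ∈ ball₂, (PeterssonForms.toForm hQ S hS 3 hD f : (Fin 2 → ℂ) → ℂ) z ≠ 0)
        ∧ (∃ z ∈ ball₂, (PeterssonForms.toForm hQ S hS 3 hD g : (Fin 2 → ℂ) → ℂ) z ≠ 0) := by
  rw [setIntegral_hodgeWedge_eq_inner_mk hQ S hS hD hDm f g, mul_ne_zero_iff,
    T5HodgePairing.inner_ne_zero_iff_of_finrank_eq_one L hL hg hf]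
  have h1 := PeterssonSpace.mk_ne_zero_iff hQ S hS 3 hD f
  have h2 := PeterssonSpace.mk_ne_zero_iff hQ S hS 3 hD g
  constructor
  · rintro ⟨-, hg0, hf0⟩
    exact ⟨h1.mp hf0, h2.mp hg0⟩
  · rintro ⟨hf0, hg0⟩
    exact ⟨by norm_num, h2.mpr hg0, h1.mpr hf0⟩

/-- **A non-zero period forces a common eigen-component.** If `V` is a subspace of the Petersson
space containing the classes of `f` and `g` and `b` is an orthonormal basis of `V` (e.g. the joint
Hecke eigenbasis of `exists_orthonormalBasis_heckeSpace`), then `∫ ω_f ∧ \overline{ω_g} ≠ 0`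
forces some basis vector `b a` to have a non-zero inner product with BOTH `f` and `g`
(Parseval: `⟪g, f⟫ = Σ_a ⟪g, b a⟫ ⟪b a, f⟫`). -/
theorem exists_inner_ne_zero_of_setIntegral_hodgeWedge_ne_zero (hDm : MeasurableSet D)
    (V : Submodule ℂ (PeterssonSpace hQ S hS 3 hD)) {κ : Type*} [Fintype κ]
    (b : OrthonormalBasis κ ℂ V) (f g : PeterssonForms hQ S hS 3 hD)
    (hf : (SeparationQuotient.mk f : PeterssonSpace hQ S hS 3 hD) ∈ V)
    (hg : (SeparationQuotient.mk g : PeterssonSpace hQ S hS 3 hD) ∈ V)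
    (hne : ∫ x in Subtype.val '' D, hodgeWedge (PeterssonForms.toForm hQ S hS 3 hD f)
        (PeterssonForms.toForm hQ S hS 3 hD g) x ≠ 0) :
    ∃ a : κ, inner ℂ (SeparationQuotient.mk g : PeterssonSpace hQ S hS 3 hD) (b a : PeterssonSpace hQ S hS 3 hD) ≠ 0
      ∧ inner ℂ (b a : PeterssonSpace hQ S hS 3 hD) (SeparationQuotient.mk f : PeterssonSpace hQ S hS 3 hD) ≠ 0 := by
  rw [setIntegral_hodgeWedge_eq_inner_mk hQ S hS hD hDm f g] at hne
  have h4 : inner ℂ (SeparationQuotient.mk g : PeterssonSpace hQ S hS 3 hD)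
      (SeparationQuotient.mk f) ≠ 0 := fun h => hne (by rw [h, mul_zero])
  have hsum := b.sum_inner_mul_inner (⟨_, hg⟩ : V) (⟨_, hf⟩ : V)
  simp only [Submodule.coe_inner] at hsum
  rw [← hsum] at h4
  obtain ⟨a, -, ha⟩ := Finset.exists_ne_zero_of_sum_ne_zero h4
  exact ⟨a, mul_ne_zero_iff.mp ha⟩

section hecke

variable {𝔪 : Submodule ℤ (Fin 3 → K)} (h𝔪 : IsLattice K 𝔪) (hS₁ : S ≤ shimuraLevelSubgroup K H 𝔪 1)
  {N' : ℕ} (hN' : N' ≠ 0) (hSN' : shimuraLevelSubgroup K H 𝔪 N' ≤ S) (hDm : MeasurableSet D)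

/-- **Multiplicity one for a joint Hecke eigenspace.** If two weight-3 forms `f`, `g` are
simultaneous eigenforms of a family of Hecke operators `T_{δ i}` with the SAME eigencharacter
`χ`, and the joint `χ`-eigenspace in the Petersson space is one-dimensional (multiplicity one),
then `(N)` for the pair — `∫ ω_f ∧ \overline{ω_g} ≠ 0` — holds iff neither form vanishes
identically on the ball. -/
theorem setIntegral_hodgeWedge_ne_zero_iff_of_hecke_eigen {ι : Type*} (δ : ι → unitaryGroup K H)
    (χ : ι → ℂ)
    (hχ : Module.finrank ℂ
      (commonEigenspace (fun i => heckeFamily hQ S hS 3 hD h𝔪 hS₁ hN' hSN' hDm (δ i)) χ) = 1)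
    (f g : PeterssonForms hQ S hS 3 hD)
    (hf : ∀ i, heckeFamily hQ S hS 3 hD h𝔪 hS₁ hN' hSN' hDm (δ i) (SeparationQuotient.mk f)
      = χ i • (SeparationQuotient.mk f : PeterssonSpace hQ S hS 3 hD))
    (hg : ∀ i, heckeFamily hQ S hS 3 hD h𝔪 hS₁ hN' hSN' hDm (δ i) (SeparationQuotient.mk g)
      = χ i • (SeparationQuotient.mk g : PeterssonSpace hQ S hS 3 hD)) :
    ∫ x in Subtype.val '' D, hodgeWedge (PeterssonForms.toForm hQ S hS 3 hD f)
        (PeterssonForms.toForm hQ S hS 3 hD g) x ≠ 0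
      ↔ (∃ z ∈ ball₂, (PeterssonForms.toForm hQ S hS 3 hD f : (Fin 2 → ℂ) → ℂ) z ≠ 0)
        ∧ (∃ z ∈ ball₂, (PeterssonForms.toForm hQ S hS 3 hD g : (Fin 2 → ℂ) → ℂ) z ≠ 0) :=
  setIntegral_hodgeWedge_ne_zero_iff_of_finrank_eq_one hQ S hS hD hDm _ hχ f g
    (mem_commonEigenspace_iff.mpr hf) (mem_commonEigenspace_iff.mpr hg)

/-- **A non-zero period is detected by a simultaneous Hecke eigenform.** On the holomorphic part of
the Petersson space of a congruence subgroup (finite-dimensional — prose), for a family of Hecke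
operators closed under inversion and commuting pairwise: if `f`, `g` are holomorphic weight-3 forms
with `∫ ω_f ∧ \overline{ω_g} ≠ 0`, there is a simultaneous Hecke eigenform `b a` of the family with
`⟪g, b a⟫ ≠ 0` and `⟪b a, f⟫ ≠ 0`. -/
theorem exists_hecke_eigenform_of_setIntegral_hodgeWedge_ne_zero {ι : Type*}
    (δ : ι → unitaryGroup K H) (σ : ι → ι) (hσ : ∀ i, δ (σ i) = (δ i)⁻¹)
    (hcomm : ∀ i j, Commute (heckeFamily hQ S hS 3 hD h𝔪 hS₁ hN' hSN' hDm (δ i))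
      (heckeFamily hQ S hS 3 hD h𝔪 hS₁ hN' hSN' hDm (δ j)))
    [FiniteDimensional ℂ (holomorphicSpace hQ S hS 3 hD)]
    (f g : PeterssonForms hQ S hS 3 hD) (hf : f ∈ holomorphicForms hQ S hS 3 hD)
    (hg : g ∈ holomorphicForms hQ S hS 3 hD)
    (hne : ∫ x in Subtype.val '' D, hodgeWedge (PeterssonForms.toForm hQ S hS 3 hD f)
        (PeterssonForms.toForm hQ S hS 3 hD g) x ≠ 0) :
    ∃ v : PeterssonSpace hQ S hS 3 hD, v ∈ holomorphicSpace hQ S hS 3 hD ∧ ‖v‖ = 1 ∧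
      (∀ i, ∃ μ : ℂ, heckeFamily hQ S hS 3 hD h𝔪 hS₁ hN' hSN' hDm (δ i) v = μ • v) ∧
      inner ℂ (SeparationQuotient.mk g : PeterssonSpace hQ S hS 3 hD) v ≠ 0 ∧
      inner ℂ v (SeparationQuotient.mk f : PeterssonSpace hQ S hS 3 hD) ≠ 0 := by
  obtain ⟨b, hb⟩ := exists_orthonormalBasis_heckeSpace_holomorphic hQ S hS 3 hD h𝔪 hS₁ hN' hSN'
    hDm δ σ hσ hcomm
  obtain ⟨a, hga, haf⟩ := exists_inner_ne_zero_of_setIntegral_hodgeWedge_ne_zero hQ S hS hD hDm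
    (holomorphicSpace hQ S hS 3 hD) b f g (mk_mem_holomorphicSpace hQ S hS 3 hD hf)
    (mk_mem_holomorphicSpace hQ S hS 3 hD hg) hne
  refine ⟨b a, (b a).2, ?_, hb a, hga, haf⟩
  exact (Submodule.norm_coe (b a)).trans (b.orthonormal.1 a)

end hecke

end Summit.Ventures.HodgeRepro2.ShimuraData
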